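import Summits.CriticalPhenomena.PercolationContinuityZ3.Theorems.Transplant.SkelTubeLevels
import Summits.CriticalPhenomena.PercolationContinuityZ3.Theorems.Transplant.KNLevelsEntrance
import Summits.CriticalPhenomena.PercolationContinuityZ3.Theorems.Transplant.KNLevelsHittable
import Literature.Probability.Percolation.KozmaNitzanHittable
import HarnessLib

/-!
# L6 (F) — the ROUTE LAW of an elongated inner route in WINDOW GRAPHS (generic re-typing of `BoxProdZ2ConcFaceRouteTube` §1–§3, SHEAR-SCOPE
# §3.9 Layer 6 (F)): a weighting `Wt` with a source set `S` WIRED (its `G`-edges pinned open) and CUT to a route world `Qt` —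
# `Skel.routeW G Wt Qt S` — is a subbox weighting of the INNER window graph `Skel.winGraph G c L` (about the contact's centre `c`) on every
# fresh region inside `Qt`, whenever `Wt` is a subbox weighting of the OUTER window graph `Skel.winGraph G w₀ R` there; and its point-source
# connection from `o ∈ S` is dominated by the link event from `S` under `Wt`

builds on p205010 (kernel theorem, internal audit signed; external expert review pending) — nothing in this file uses p205010.
Lane `prim-bschramm`, typed by the `prim-hp-8` lineage (gen 24); helper file (`--supports stmt-CriticalPhenomena-4575 --as helper`).
NEW FILE; generic over the vertex type `V` and the graph `G` (no skeleton structure is used): the product's two tubes `π' ⊆ π` become two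
window graphs with arbitrary centres and depths, the only coupling being that the fresh region lies in both graph balls.
* `isSubbox_restrW_win` — restriction to a route world inside another window keeps subboxes;
* `routeW G Wt Qt S := restrW Qt (pinW Wt (edgesIn G S) (edgesIn G S))`; `routeW_eq_one` (on the edges of `S`), `routeW_ge` (on the edges of a
  subbox region), `routeW_eq_zero_of_not_mem_edgeSet`, `pinW_edgesIn_eq_zero_of_not_mem_edgeSet`, **`isSubbox_routeW`**, `finSupp_routeW`;
* **`real_biUnion_openConn_routeW_le_linkIn`** — `P_{routeW}(⋃_{t ∈ Ft} o ↔ t) ≤ P_{Wt}(linkIn Qt S Ft)` (`o ∈ S ⊆ Qt`, `S ∩ Ft = ∅`).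
The first hop from the wired fat prism (product §4 `wired_prism_hsrc_of_le`) belongs with the kit layer and is not ported here.
[cite: KozmaNitzan2024, §4 Lemma 10 (p. 17: subbox), Lemma 11 (p. 22: the wired cube, Ω), p. 24 (P(o ↔^A ·)), p. 30 (Step III)]
-/

noncomputable section

open MeasureTheory
open scoped Classical

namespace Summit.CriticalPhenomena.PercolationContinuityZ3.Theorems

namespace Transplant

namespace Skel

open Literature.Probability.Percolation Literature.Probability.LatticeModels SimpleGraph KNLevels
open Literature.Probability.Percolation.KozmaNitzan
open Literature.Barriers.CriticalPhenomena (graphBall graphBall_finite mem_graphBall_self graphBall_mono)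

variable {V : Type} [DecidableEq V] (G : SimpleGraph V) [G.LocallyFinite]

/-! ## §1 Subboxes under restriction to a route world inside another window -/

/-- **Restriction to a route world inside another window keeps subboxes.**  If `W` vanishes off the edges of `G` and `Dd` is a subbox of
`W` in the window graph `winGraph G w₀ R`, with `Dd` inside that graph's ball, then for `Dd ⊆ Qt` with `Qt` inside the ball of the window
graph `winGraph G c L`, `Dd` is a subbox of `restrW Qt W` in `winGraph G c L` (exterior attachments from outside `Qt` are cut by the restriction;
inside `Qt` both window graphs induce `G`). [cite: KozmaNitzan2024, §4 p. 17 (subbox), p. 22 (Ω)] -/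
theorem isSubbox_restrW_win {w₀ c : V} {R L : ℕ} {Wt : Sym2 V → unitInterval} {p : unitInterval} (hWG : ∀ e, e ∉ G.edgeSet → Wt e = 0)
    {Qt Dd : Finset V} (hDQ : Dd ⊆ Qt) (hQL : ∀ u ∈ Qt, u ∈ graphBall G c L) (hDR : ∀ u ∈ Dd, u ∈ graphBall G w₀ R)
    (hW : IsSubbox (winGraph G w₀ R) Wt p Dd) : IsSubbox (winGraph G c L) (restrW (↑Qt : Set V) Wt) p Dd := by
  refine ⟨fun u hu v hv huv => ?_, fun u hu v hv hne huv => ?_, fun v hv hvb x hx => ?_⟩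
  · rw [restrW_apply_of_mem _ (mk_mem_wireSet_iff.2 ⟨Finset.mem_coe.2 (hDQ hu), Finset.mem_coe.2 (hDQ hv), huv.ne⟩)]
    exact hW.adj u hu v hv ((winGraph_adj G).2 ⟨((winGraph_adj G).1 huv).1, hDR u hu, hDR v hv⟩)
  · rw [restrW_apply_of_mem _ (mk_mem_wireSet_iff.2 ⟨Finset.mem_coe.2 (hDQ hu), Finset.mem_coe.2 (hDQ hv), hne⟩)]
    refine hW.nadj u hu v hv hne fun h' => huv ?_
    exact (winGraph_adj G).2 ⟨((winGraph_adj G).1 h').1, hQL u (hDQ hu), hQL v (hDQ hv)⟩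
  · by_cases hxQ : s(x, v) ∈ wireSet (↑Qt : Set V)
    · rw [restrW_apply_of_mem _ hxQ]
      obtain ⟨hxQ', -, -⟩ := mk_mem_wireSet_iff.1 hxQ
      -- `x` and `v` are not adjacent: a `G`-edge between them would be an inner-window edge into the interior vertex `v`
      refine hWG _ fun hedge => hvb ?_
      rw [SimpleGraph.mem_edgeSet] at hedge
      exact mem_innerBoundary_iff.2 ⟨hv, x, hx, (winGraph_adj G).2 ⟨hedge.symm, hQL v (hDQ hv), hQL x (Finset.mem_coe.1 hxQ')⟩⟩
    · exact restrW_apply_of_not_mem _ hxQ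

/-! ## §2 The route law -/

/-- **The route law**: `Wt` with the `G`-edges inside the source set `S` pinned open, cut to the route world `Qt`.
[cite: KozmaNitzan2024, §4 Lemma 11 (p. 22: the cube wired to a point, the graph Ω)] -/
def routeW (Wt : Sym2 V → unitInterval) (Qt S : Finset V) : Sym2 V → unitInterval :=
  restrW (↑Qt : Set V) (pinW Wt (↑(edgesIn G S) : Set (Sym2 V)) ↑(edgesIn G S))

/-- The pinned edges of `S` are pairs inside `S`. [folklore] -/
theorem coe_edgesIn_subset_wireSet (S : Finset V) : (↑(edgesIn G S) : Set (Sym2 V)) ⊆ wireSet (↑S : Set V) := by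
  intro e he
  obtain ⟨hedge, hends⟩ := mem_edgesIn_iff.1 (Finset.mem_coe.1 he)
  induction e using Sym2.ind with
  | h x y =>
    exact mk_mem_wireSet_iff.2 ⟨Finset.mem_coe.2 (hends x (Sym2.mem_mk_left x y)), Finset.mem_coe.2 (hends y (Sym2.mem_mk_right x y)),
      ((SimpleGraph.mem_edgeSet _).1 hedge).ne⟩

/-- **The route law gives weight `1` to the edges of `G` inside `S`** (`S ⊆ Qt`). [folklore] -/
theorem routeW_eq_one {Wt : Sym2 V → unitInterval} {Qt S : Finset V} (hSQ : S ⊆ Qt) {u u' : V} (hu : u ∈ S) (hu' : u' ∈ S)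
    (hadj : G.Adj u u') : routeW G Wt Qt S s(u, u') = 1 := by
  have hF : s(u, u') ∈ (↑(edgesIn G S) : Set (Sym2 V)) :=
    Finset.mem_coe.2 (mem_edgesIn_iff.2 ⟨(SimpleGraph.mem_edgeSet _).2 hadj, fun z hz => by
      rcases Sym2.mem_iff.1 hz with rfl | rfl
      exacts [hu, hu']⟩)
  unfold routeW
  rw [restrW_apply_of_mem _ (mk_mem_wireSet_iff.2 ⟨Finset.mem_coe.2 (hSQ hu), Finset.mem_coe.2 (hSQ hu'), hadj.ne⟩),
    pinW_apply_of_mem_of_mem _ hF hF]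

/-- **The route law gives weight `≥ q` to the edges of a subbox region `D` of `Wt` (in `winGraph G w₀ R`, `D` inside its ball) on any
`F ⊆ D ∩ Qt`.** [folklore] -/
theorem routeW_ge {w₀ : V} {R : ℕ} {Wt : Sym2 V → unitInterval} {q : unitInterval} {D : Finset V} (hWD : IsSubbox (winGraph G w₀ R) Wt q D)
    (hDR : ∀ u ∈ D, u ∈ graphBall G w₀ R) {Qt S F : Finset V} (hFQ : F ⊆ Qt) (hFD : F ⊆ D) {u u' : V} (hu : u ∈ F) (hu' : u' ∈ F)
    (hadj : G.Adj u u') : q ≤ routeW G Wt Qt S s(u, u') := by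
  unfold routeW
  rw [restrW_apply_of_mem _ (mk_mem_wireSet_iff.2 ⟨Finset.mem_coe.2 (hFQ hu), Finset.mem_coe.2 (hFQ hu'), hadj.ne⟩)]
  by_cases hF : s(u, u') ∈ (↑(edgesIn G S) : Set (Sym2 V))
  · rw [pinW_apply_of_mem_of_mem _ hF hF]; exact unitInterval.le_one _
  · rw [pinW_apply_of_not_mem _ _ hF, hWD.adj u (hFD hu) u' (hFD hu') ((winGraph_adj G).2 ⟨hadj, hDR u (hFD hu), hDR u' (hFD hu')⟩)]

/-- **The route law vanishes off the edges of `G`** when `Wt` does. [folklore] -/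
theorem routeW_eq_zero_of_not_mem_edgeSet {Wt : Sym2 V → unitInterval} (hWG : ∀ e, e ∉ G.edgeSet → Wt e = 0) (Qt S : Finset V)
    {e : Sym2 V} (he : e ∉ G.edgeSet) : routeW G Wt Qt S e = 0 := by
  have hF : e ∉ (↑(edgesIn G S) : Set (Sym2 V)) := fun h' => he (mem_edgesIn_iff.1 (Finset.mem_coe.1 h')).1
  have hle := restrW_le (↑Qt : Set V) (pinW Wt (↑(edgesIn G S) : Set (Sym2 V)) ↑(edgesIn G S)) e
  rw [pinW_apply_of_not_mem _ _ hF, hWG e he] at hle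
  exact le_antisymm hle bot_le

/-- The pinned law vanishes off the edges of `G` when `Wt` does. [folklore] -/
theorem pinW_edgesIn_eq_zero_of_not_mem_edgeSet {Wt : Sym2 V → unitInterval} (hWG : ∀ e, e ∉ G.edgeSet → Wt e = 0) (S : Finset V)
    {e : Sym2 V} (he : e ∉ G.edgeSet) : pinW Wt (↑(edgesIn G S) : Set (Sym2 V)) ↑(edgesIn G S) e = 0 := by
  have hF : e ∉ (↑(edgesIn G S) : Set (Sym2 V)) := fun h' => he (mem_edgesIn_iff.1 (Finset.mem_coe.1 h')).1
  rw [pinW_apply_of_not_mem _ _ hF, hWG e he]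

/-- **The route law is a subbox weighting of the inner window graph on every fresh region**: if `Dd` is a subbox of `Wt` in
`winGraph G w₀ R` (inside its ball), `Dd ⊆ Qt` with `Qt` inside the ball of `winGraph G c L`, and `Dd` misses the wired set `S`, then `Dd` is a
subbox of `routeW G Wt Qt S` in `winGraph G c L`. [cite: KozmaNitzan2024, §4 p. 17 (subbox), Lemma 11 (p. 22: Ω minus the wired cube)] -/
theorem isSubbox_routeW {w₀ c : V} {R L : ℕ} {Wt : Sym2 V → unitInterval} {q : unitInterval} (hWG : ∀ e, e ∉ G.edgeSet → Wt e = 0)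
    {Qt S Dd : Finset V} (hDQ : Dd ⊆ Qt) (hQL : ∀ u ∈ Qt, u ∈ graphBall G c L) (hDR : ∀ u ∈ Dd, u ∈ graphBall G w₀ R)
    (hSD : Disjoint S Dd) (hW : IsSubbox (winGraph G w₀ R) Wt q Dd) : IsSubbox (winGraph G c L) (routeW G Wt Qt S) q Dd :=
  isSubbox_restrW_win G (fun _ he => pinW_edgesIn_eq_zero_of_not_mem_edgeSet G hWG S he) hDQ hQL hDR
    (hW.pinW_of_disjoint hSD (coe_edgesIn_subset_wireSet G S) _)

/-- The route law is supported on the route world. [folklore] -/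
theorem finSupp_routeW (Wt : Sym2 V → unitInterval) (Qt S : Finset V) : FinSupp (routeW G Wt Qt S) Qt := by
  unfold routeW; exact KNLevels.finSupp_restrW Qt _

/-! ## §3 Domination: the point-source connection under the route law versus the link event under `Wt` -/

/-- **`P_{routeW}(⋃_{t ∈ Ft} o ↔ t) ≤ P_{Wt}(linkIn Qt S Ft)`** for `o ∈ S ⊆ Qt`, `S ∩ Ft = ∅`: under the cut law open paths stay in `Qt`, a
connection from `o ∈ S` inside `Qt` is a link from `S`, and wiring `S` does not change the link probability.
[cite: KozmaNitzan2024, §4 Lemma 11 (p. 22), p. 24 (P(o ↔^A ·))] -/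
theorem real_biUnion_openConn_routeW_le_linkIn [Countable V] (Wt : Sym2 V → unitInterval) {Qt S Ft : Finset V} (hSQ : S ⊆ Qt)
    (hSF : Disjoint S Ft) {o : V} (ho : o ∈ S) :
    (prodBernoulli (routeW G Wt Qt S)).real (⋃ t ∈ Ft, openConn o t) ≤ (prodBernoulli Wt).real (linkIn (↑Qt : Set V) S Ft) := by
  have h1 : (prodBernoulli (routeW G Wt Qt S)).real (⋃ t ∈ Ft, openConn o t) =
      (prodBernoulli (pinW Wt (↑(edgesIn G S) : Set (Sym2 V)) ↑(edgesIn G S))).real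
        (⋃ t ∈ (↑Ft : Set V), openConnIn (↑Qt : Set V) o t) := by
    unfold routeW
    rw [← prodBernoulli_restrW_real_biUnion_openConn (pinW Wt (↑(edgesIn G S) : Set (Sym2 V)) ↑(edgesIn G S)) (↑Qt : Set V)
      (Finset.mem_coe.2 (hSQ ho))]
    simp only [Finset.mem_coe]
  have h2 : (⋃ t ∈ (↑Ft : Set V), openConnIn (↑Qt : Set V) o t) ⊆ linkIn (↑Qt : Set V) S Ft := by
    intro ω hω
    simp only [Set.mem_iUnion, exists_prop, Finset.mem_coe] at hω
    obtain ⟨t, ht, hot⟩ := hω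
    exact mem_linkIn_iff.2 ⟨o, ho, t, ht, hot⟩
  calc (prodBernoulli (routeW G Wt Qt S)).real (⋃ t ∈ Ft, openConn o t)
      = (prodBernoulli (pinW Wt (↑(edgesIn G S) : Set (Sym2 V)) ↑(edgesIn G S))).real
          (⋃ t ∈ (↑Ft : Set V), openConnIn (↑Qt : Set V) o t) := h1
    _ ≤ (prodBernoulli (pinW Wt (↑(edgesIn G S) : Set (Sym2 V)) ↑(edgesIn G S))).real (linkIn (↑Qt : Set V) S Ft) :=
        measureReal_mono h2 (measure_ne_top _ _)
    _ = (prodBernoulli Wt).real (linkIn (↑Qt : Set V) S Ft) := (real_linkIn_eq_pinW_source Wt Qt hSF (coe_edgesIn_subset_wireSet G S) _).symm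

end Skel

end Transplant

end Summit.CriticalPhenomena.PercolationContinuityZ3.Theorems

end
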